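import Literature.Analysis.FluidPDE.SereginSverakScaledEnergyProofs
import Literature.Analysis.FluidPDE.SereginSverakSuitableProofs
import Literature.Analysis.FluidPDE.SereginSverakBlowupSelection
import Literature.Analysis.FluidPDE.SuitableWeakSliced
import HarnessLib

/-!
# Seregin–Šverák 2009, (as12): the local energy estimate on the cylinders `Q(z₀, r)`

G. Seregin, V. Šverák, *On Type I singularities of the local axi-symmetric solutions of the
Navier–Stokes equations*, Comm. PDE 34 (2009), 171–201 = arXiv:0804.1803. In the proof of
Lemma 3.5 (arXiv p. 10) the authors "consider the local energy inequality

  `E(z_b, r/2; v) + A(z_b, r/2; v) ≤ c (C^{2/3}(z_b, r; v) + C(z_b, r; v) + D(z_b, r; q))` (as12)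

… `z_b` and `r` satisfy conditions (as5)", without further comment: it is the routine
consequence of the (sliced) local energy inequality of Def. 2.2 — available for the solutions
of Thm. 3.1 by Remark 3.4 — tested with a cut-off adapted to `Q(z_b, r)`, plus Hölder's
inequality. The accepted file `SereginSverakScaledEnergy.lean` vendors (as12) as the named
fact `SereginSverak2009.LocalEnergyEstimate` (hypotheses: the assumptions of Thm. 3.1) and
Remark 3.4 is the named fact `SereginSverak2009.SuitableOfBounded`
(`SereginSverakAxisymmetric.lean`). This file PROVES the routine part:

* `SereginSverak2009.dissipationE_add_energyA_le_of_suitable` — for every suitable weak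
  solution `(u, p)` (accepted `IsSuitableWeakSolutionOn Q 1 0 u p`) with `|u|³ ∈ L¹_loc(Q)`,
  every weak spatial gradient `G` of `u` on `Q`, and every cylinder `Q(z₀, r) ⊆ Q`:
  `E(z₀, r/2; G) + A(z₀, r/2; u) ≤ c (C^{2/3} + C + D)(z₀, r)` with a universal `c`;
* `SereginSverak2009.LocalEnergyEstimate.of_suitable : SuitableOfBounded → LocalEnergyEstimate`
  — (as12) from Remark 3.4, as in the paper ((r3) ⇒ (r2) by
  `isBoundedAwayFromZero_of_isTypeIOnCyl`; `Q(z_b, r) ⊆ Q` by `parCyl_axis_subset`);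
* `SereginSverak2009.LocalEnergyEstimate_holds : LocalEnergyEstimate` — the DISCHARGE, through
  the accepted `SuitableOfBounded_holds` (Remark 3.4, `SereginSverakSuitableProofs.lean`);
* `SereginSverak2009.ScaledEnergyBound.of_gradientEnergyBound_of_pressureDecay` — Lemma 3.5
  from its two remaining named inputs (as6) and (as13) ((as11) is the accepted
  `CubicAbsorption_holds`, `SereginSverakScaledEnergyProofs.lean`).

## Proof of the estimate

1. Cut-off (§ profile): `Φ(t, x) = Φ₁((t - t₀)/r², (x - x₀)/r)` with
   `Φ₁(s, y) = ϑ(s) χ(y)`, `ϑ`, `χ` Mathlib bump functions (`ContDiffBump`) with `Φ₁ = 1` on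
   `[-1/4, 1/2] × B̄(0, 3/4) ⊇ Q(0, 1/2)` and `supp Φ₁ ⊆ (-3/4, 1) × B(0, 9/10)`; realised as
   `stPull` so that the tree's chain rules give `|∂ₜΦ|, |ΔΦ| ≤ M/r²`, `‖∇Φ‖ ≤ M/r` with `M`
   a sup bound of the derivatives of `Φ₁` (no explicit value needed). Below `t₀` the support
   of `Φ` lies in `Q(z₀, r)` (here `B(x₀, r) ⊆ 𝒞(x₀, r)` and `𝒞(x₀, r/2) ⊆ B̄(x₀, r/√2)`).
2. The sliced local energy inequality below the level `t₀`
   (`IsSuitableWeakSolutionOn.ae_localEnergy_slice_ennreal_of_forall_lt`,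
   `SuitableWeakSliced.lean`, built on the accepted `ae_localEnergy_slice`) gives for a.e. `s < t₀`
   `∫ Φ(s)|u(s)|² + 2 ∫∫_{t<s} Φ|∇u|² ≤ ∫∫_{t<s} R[Φ] ≤ 𝔅`,
   `𝔅 = (2M/r²) ∫_{Q_r}|u|² + (M/r) ∫_{Q_r}|u|³ + (2M/r) ∫_{Q_r}|p||u|`.
3. `A(z₀, r/2) ≤ (r/2)⁻¹ 𝔅` (essential supremum of an a.e. bound) and
   `E(z₀, r/2) ≤ (r/2)⁻¹ 𝔅` (exhaust `Q(z₀, r/2)` by the levels `t < sₙ ↑ t₀` and pick good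
   slicing times above each level).
4. Hölder: `∫_{Q_r}|u|² ≤ |Q_r|^{1/3} (∫|u|³)^{2/3}`, `|Q_r| ≤ 8 r⁵ |B(0,1)|`
   (accepted `volume_parCyl_le`),
   `∫|p||u| ≤ (∫|p|^{3/2})^{2/3} (∫|u|³)^{1/3} ≤ r² (D + C)` (Young), and `∫|u|³ = r² C`,
   `∫|p|^{3/2} = r² D`; the powers of `r` cancel.

## References

* G. Seregin, V. Šverák, Comm. PDE 34 (2009), arXiv:0804.1803: Def. 2.2 (p. 6), Remark 3.4,
  §3 functionals, proof of Lemma 3.5, (as12) (pp. 9–10). [`SereginSverak2009`]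
* L. Caffarelli, R. Kohn, L. Nirenberg, CPAM 35 (1982), §2 (2.5), (2.9'), Lemma 5.1 ff.
  [`CaffarelliKohnNirenberg1982`]
-/

noncomputable section

open MeasureTheory Set Function Filter Topology TopologicalSpace Metric InnerProductSpace
open scoped NNReal ENNReal RealInnerProductSpace Laplacian

namespace Literature.Analysis.FluidPDE

namespace SereginSverak2009

/-- Local notation for physical space `ℝ³ = EuclideanSpace ℝ (Fin 3)`. -/
local notation "ℝ³" => EuclideanSpace ℝ (Fin 3)

/-! ### The cut-off profile at unit scale and its rescalings -/

/-- Time profile of the cut-off: a smooth bump on `ℝ` equal to `1` on `[-1/4, 1/2]` and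
supported in `(-3/4, 1)` (centre `1/8`, radii `3/8 < 7/8`). [folklore] -/
def timeProfile : ContDiffBump (1 / 8 : ℝ) := ⟨3 / 8, 7 / 8, by norm_num, by norm_num⟩

/-- Space profile of the cut-off: a smooth bump on `ℝ³` equal to `1` on the closed ball of
radius `3/4` and supported in the ball of radius `9/10`. [folklore] -/
def spaceProfile : ContDiffBump (0 : ℝ³) := ⟨3 / 4, 9 / 10, by norm_num, by norm_num⟩

/-- The unit cut-off `Φ₁(s, y) = ϑ(s) χ(y)`: smooth, `0 ≤ Φ₁ ≤ 1`, `Φ₁ = 1` on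
`[-1/4, 1/2] × B̄(0, 3/4) ⊇ Q(0, 1/2)`, supported in `(-3/4, 1) × B(0, 9/10)`. [folklore] -/
def unitCutoff (s : ℝ) (y : ℝ³) : ℝ :=
  (timeProfile : ℝ → ℝ) s * (spaceProfile : ℝ³ → ℝ) y

/-- The cut-off adapted to the cylinder `Q(z₀, r)`: `Φ(t, x) = Φ₁((t - t₀)/r², (x - x₀)/r)`,
realised as a pull-back `stPull` of `unitCutoff` (so that the tree's chain rules apply).
[folklore] -/
def cylCutoff (z₀ : ℝ × ℝ³) (r : ℝ) : ℝ → ℝ³ → ℝ :=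
  stPull (r ^ 2)⁻¹ r⁻¹ (-((r ^ 2)⁻¹ * z₀.1)) (-(r⁻¹ • z₀.2)) unitCutoff

/-- Unfolding `unitCutoff`. [folklore] -/
theorem unitCutoff_apply (s : ℝ) (y : ℝ³) :
    unitCutoff s y = (timeProfile : ℝ → ℝ) s * (spaceProfile : ℝ³ → ℝ) y :=
  rfl

/-- `0 ≤ Φ₁`. [folklore] -/
theorem unitCutoff_nonneg (s : ℝ) (y : ℝ³) : 0 ≤ unitCutoff s y :=
  mul_nonneg timeProfile.nonneg spaceProfile.nonneg

/-- `Φ₁ ≤ 1`. [folklore] -/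
theorem unitCutoff_le_one (s : ℝ) (y : ℝ³) : unitCutoff s y ≤ 1 :=
  mul_le_one₀ timeProfile.le_one spaceProfile.nonneg spaceProfile.le_one

/-- `Φ₁ = 1` on `[-1/4, 1/2] × B̄(0, 3/4)`. [folklore] -/
theorem unitCutoff_eq_one {s : ℝ} {y : ℝ³} (hs : s ∈ Icc (-1 / 4 : ℝ) (1 / 2)) (hy : ‖y‖ ≤ 3 / 4) :
    unitCutoff s y = 1 := by
  rw [unitCutoff_apply, timeProfile.one_of_mem_closedBall, spaceProfile.one_of_mem_closedBall,
    one_mul]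
  · simpa [spaceProfile] using hy
  · rw [mem_closedBall, Real.dist_eq, abs_le]
    simp only [timeProfile]
    constructor <;> linarith [hs.1, hs.2]

/-- Off `(-3/4, 1) × B(0, 9/10)` the unit cut-off vanishes; contrapositive form. [folklore] -/
theorem unitCutoff_ne_zero {s : ℝ} {y : ℝ³} (h : unitCutoff s y ≠ 0) :
    s ∈ Ioo (-3 / 4 : ℝ) 1 ∧ ‖y‖ < 9 / 10 := by
  obtain ⟨h1, h2⟩ := mul_ne_zero_iff.1 h
  have h1' : s ∈ Function.support (timeProfile : ℝ → ℝ) := h1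
  have h2' : y ∈ Function.support (spaceProfile : ℝ³ → ℝ) := h2
  rw [ContDiffBump.support_eq, mem_ball, Real.dist_eq] at h1'
  rw [ContDiffBump.support_eq, mem_ball, dist_zero_right] at h2'
  refine ⟨?_, by simpa [spaceProfile] using h2'⟩
  simp only [timeProfile] at h1'
  rw [abs_lt] at h1'
  constructor <;> linarith [h1'.1, h1'.2]

/-- The unit cut-off is a space–time test function on `ℝ × ℝ³`. [folklore] -/
theorem isSpaceTimeTestOn_unitCutoff : IsSpaceTimeTestOn (⊤ : Opens (ℝ × ℝ³)) unitCutoff := by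
  refine ⟨(timeProfile.contDiff.comp contDiff_fst).mul (spaceProfile.contDiff.comp contDiff_snd),
    ?_, fun _ _ => trivial⟩
  refine HasCompactSupport.intro ((isCompact_Icc (a := (-1 : ℝ)) (b := 1)).prod
    (isCompact_closedBall (0 : ℝ³) 1)) fun z hz => ?_
  by_contra h
  obtain ⟨h1, h2⟩ := unitCutoff_ne_zero h
  exact hz ⟨⟨by linarith [h1.1], h1.2.le⟩, mem_closedBall_zero_iff.2 (by linarith)⟩

/-- Sup bounds for the derivatives of the unit cut-off: `|∂ₛΦ₁|, |ΔΦ₁| ≤ M`, `‖∇Φ₁‖ ≤ M` for a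
single constant `M ≥ 0` (continuous functions supported in the compact support of `Φ₁`).
[folklore] -/
theorem exists_unitCutoff_deriv_bound : ∃ M : ℝ, 0 ≤ M ∧
    (∀ s y, |timeDeriv unitCutoff s y| ≤ M) ∧ (∀ s y, |(Δ (unitCutoff s)) y| ≤ M) ∧
    (∀ s y, ‖gradient (unitCutoff s) y‖ ≤ M) := by
  have hζ := isSpaceTimeTestOn_unitCutoff
  have hKc : IsCompact (tsupport (uncurry unitCutoff)) := hζ.hasCompactSupport
  have hw0 : ∀ z ∉ tsupport (uncurry unitCutoff), unitCutoff z.1 z.2 = 0 ∧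
      gradient (unitCutoff z.1) z.2 = 0 ∧ (Δ (unitCutoff z.1)) z.2 = 0 ∧
      timeDeriv unitCutoff z.1 z.2 = 0 := fun z hz => weights_eq_zero_of_notMem_tsupport hz
  have hc_t : Continuous fun z : ℝ × ℝ³ => timeDeriv unitCutoff z.1 z.2 := hζ.continuous_timeDeriv
  have hc_l : Continuous fun z : ℝ × ℝ³ => (Δ (unitCutoff z.1)) z.2 := by
    have h := ((hζ.isSmoothSpaceTimeOn univ).laplacian uniqueDiffOn_univ).continuousOn
    rw [univ_prod_univ, continuousOn_univ] at h
    exact h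
  have hc_g : Continuous fun z : ℝ × ℝ³ => gradient (unitCutoff z.1) z.2 := by
    have h := ((hζ.isSmoothSpaceTimeOn univ).gradient uniqueDiffOn_univ).continuousOn
    rw [univ_prod_univ, continuousOn_univ] at h
    exact h
  obtain ⟨Mt, hMt⟩ := hc_t.bounded_above_of_compact_support
    (HasCompactSupport.intro hKc fun z hz => (hw0 z hz).2.2.2)
  obtain ⟨Ml, hMl⟩ := hc_l.bounded_above_of_compact_support
    (HasCompactSupport.intro hKc fun z hz => (hw0 z hz).2.2.1)
  obtain ⟨Mg, hMg⟩ := hc_g.bounded_above_of_compact_support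
    (HasCompactSupport.intro hKc fun z hz => (hw0 z hz).2.1)
  refine ⟨max (max Mt Ml) (max Mg 0), le_max_of_le_right (le_max_right _ _),
    fun s y => ?_, fun s y => ?_, fun s y => ?_⟩
  · exact ((Real.norm_eq_abs _).symm.le.trans (hMt (s, y))).trans
      (le_max_of_le_left (le_max_left _ _))
  · exact ((Real.norm_eq_abs _).symm.le.trans (hMl (s, y))).trans
      (le_max_of_le_left (le_max_right _ _))
  · exact (hMg (s, y)).trans (le_max_of_le_right (le_max_left _ _))

variable {z₀ : ℝ × ℝ³} {r : ℝ}

/-- Unfolding `cylCutoff`: `Φ(t, x) = Φ₁((t - t₀)/r², r⁻¹ (x - x₀))`. [folklore] -/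
theorem cylCutoff_apply (z₀ : ℝ × ℝ³) (r t : ℝ) (x : ℝ³) :
    cylCutoff z₀ r t x = unitCutoff ((r ^ 2)⁻¹ * (t - z₀.1)) (r⁻¹ • (x - z₀.2)) := by
  simp only [cylCutoff, stPull_apply, smul_sub]
  congr 1
  · ring
  · abel

/-- `0 ≤ Φ`. [folklore] -/
theorem cylCutoff_nonneg (z₀ : ℝ × ℝ³) (r t : ℝ) (x : ℝ³) : 0 ≤ cylCutoff z₀ r t x := by
  rw [cylCutoff_apply]; exact unitCutoff_nonneg _ _

/-- `Φ ≤ 1`. [folklore] -/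
theorem cylCutoff_le_one (z₀ : ℝ × ℝ³) (r t : ℝ) (x : ℝ³) : cylCutoff z₀ r t x ≤ 1 := by
  rw [cylCutoff_apply]; exact unitCutoff_le_one _ _

/-- The scaled cut-off is a space–time test function on `ℝ × ℝ³` (`r ≠ 0`). [folklore] -/
theorem isSpaceTimeTestOn_cylCutoff (z₀ : ℝ × ℝ³) (hr : r ≠ 0) :
    IsSpaceTimeTestOn (⊤ : Opens (ℝ × ℝ³)) (cylCutoff z₀ r) :=
  (isSpaceTimeTestOn_unitCutoff.stPull (inv_ne_zero (pow_ne_zero 2 hr)) (inv_ne_zero hr)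
    _ _).mono le_top

/-- Where the scaled cut-off does not vanish: `t > t₀ - (3/4) r²` and `‖x - x₀‖ < (9/10) r`.
[folklore] -/
theorem cylCutoff_ne_zero (hr : 0 < r) {t : ℝ} {x : ℝ³} (h : cylCutoff z₀ r t x ≠ 0) :
    z₀.1 - 3 / 4 * r ^ 2 < t ∧ ‖x - z₀.2‖ < 9 / 10 * r := by
  rw [cylCutoff_apply] at h
  obtain ⟨h1, h2⟩ := unitCutoff_ne_zero h
  have hr2 : 0 < r ^ 2 := by positivity
  constructor
  · have h1' := h1.1
    rw [lt_inv_mul_iff₀ hr2] at h1'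
    nlinarith
  · rw [norm_smul, norm_inv, Real.norm_eq_abs, abs_of_pos hr, inv_mul_lt_iff₀ hr] at h2
    linarith

/-- The support of the scaled cut-off lies in `{t ≥ t₀ - (3/4) r²} × B̄(x₀, (9/10) r)`.
[folklore] -/
theorem tsupport_cylCutoff_subset (hr : 0 < r) :
    tsupport (uncurry (cylCutoff z₀ r)) ⊆
      {z : ℝ × ℝ³ | z₀.1 - 3 / 4 * r ^ 2 ≤ z.1 ∧ ‖z.2 - z₀.2‖ ≤ 9 / 10 * r} := by
  refine closure_minimal (fun z hz => ?_) ?_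
  · have h := cylCutoff_ne_zero (z₀ := z₀) hr (t := z.1) (x := z.2) hz
    exact ⟨h.1.le, h.2.le⟩
  · exact (isClosed_le continuous_const continuous_fst).inter
      (isClosed_le (continuous_norm.comp (continuous_snd.sub continuous_const)) continuous_const)

/-- `Φ = 1` on the half cylinder: for `t₀ - r²/4 ≤ t ≤ t₀ + r²/2` and `‖x - x₀‖ ≤ (3/4) r`.
[folklore] -/
theorem cylCutoff_eq_one (hr : 0 < r) {t : ℝ} {x : ℝ³}
    (ht : t ∈ Icc (z₀.1 - r ^ 2 / 4) (z₀.1 + r ^ 2 / 2)) (hx : ‖x - z₀.2‖ ≤ 3 / 4 * r) :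
    cylCutoff z₀ r t x = 1 := by
  rw [cylCutoff_apply]
  have hr2 : 0 < r ^ 2 := by positivity
  refine unitCutoff_eq_one ⟨?_, ?_⟩ ?_
  · rw [le_inv_mul_iff₀ hr2]; linarith [ht.1]
  · rw [inv_mul_le_iff₀ hr2]; linarith [ht.2]
  · rw [norm_smul, norm_inv, Real.norm_eq_abs, abs_of_pos hr, inv_mul_le_iff₀ hr]
    linarith

/-- Derivative bounds for the scaled cut-off: `|∂ₜΦ| ≤ M/r²`, `|ΔΦ| ≤ M/r²`, `‖∇Φ‖ ≤ M/r`,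
with the constant of `exists_unitCutoff_deriv_bound` (chain rules `timeDeriv_stPull`,
`laplacian_stPull`, `gradient_stPull`). [folklore] -/
theorem cylCutoff_deriv_bound {M : ℝ} (hM : (∀ s y, |timeDeriv unitCutoff s y| ≤ M) ∧
    (∀ s y, |(Δ (unitCutoff s)) y| ≤ M) ∧ (∀ s y, ‖gradient (unitCutoff s) y‖ ≤ M))
    (hr : 0 < r) (t : ℝ) (x : ℝ³) :
    |timeDeriv (cylCutoff z₀ r) t x| ≤ M / r ^ 2 ∧ |(Δ (cylCutoff z₀ r t)) x| ≤ M / r ^ 2 ∧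
      ‖gradient (cylCutoff z₀ r t) x‖ ≤ M / r := by
  have hr2 : 0 < r ^ 2 := by positivity
  refine ⟨?_, ?_, ?_⟩
  · rw [cylCutoff, timeDeriv_stPull, smul_eq_mul, abs_mul, abs_of_pos (inv_pos.2 hr2),
      div_eq_inv_mul]
    exact mul_le_mul_of_nonneg_left (hM.1 _ _) (inv_pos.2 hr2).le
  · rw [cylCutoff, laplacian_stPull _ _ _ _ _ _ _
      (isSpaceTimeTestOn_unitCutoff.contDiff_slice_two _), smul_eq_mul, abs_mul, inv_pow,
      abs_of_pos (inv_pos.2 hr2), div_eq_inv_mul]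
    exact mul_le_mul_of_nonneg_left (hM.2.1 _ _) (inv_pos.2 hr2).le
  · rw [cylCutoff, gradient_stPull, norm_smul, norm_inv, Real.norm_eq_abs, abs_of_pos hr,
      div_eq_inv_mul]
    exact mul_le_mul_of_nonneg_left (hM.2.2 _ _) (inv_pos.2 hr).le

/-! ### Geometry of the cylinders and of the cut-off -/

/-- Points at distance `< R` from `x₀` lie in the cylinder `𝒞(x₀, R)`. [folklore] -/
theorem mem_spaceCyl_of_norm_lt {x₀ x : ℝ³} {R : ℝ} (h : ‖x - x₀‖ < R) : x ∈ spaceCyl x₀ R := by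
  rw [mem_spaceCyl]
  refine ⟨(cylRadius_le_norm' _).trans_lt h, ?_⟩
  have h2 : |(x - x₀) 2| ≤ ‖x - x₀‖ := by
    have hsq : ((x - x₀) 2) ^ 2 ≤ ‖x - x₀‖ ^ 2 := by
      rw [norm_sq_eq_cylRadius_sq_add]
      nlinarith [sq_nonneg (cylRadius (x - x₀))]
    exact (sq_le_sq.1 hsq).trans_eq (abs_norm _)
  rw [PiLp.sub_apply] at h2
  exact h2.trans_lt h

/-- Points of `𝒞(x₀, R)` have `‖x - x₀‖² < 2R²`. [folklore] -/
theorem norm_sub_sq_lt_of_mem_spaceCyl {x₀ x : ℝ³} {R : ℝ} (h : x ∈ spaceCyl x₀ R) :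
    ‖x - x₀‖ ^ 2 < 2 * R ^ 2 := by
  rw [mem_spaceCyl] at h
  rw [norm_sq_eq_cylRadius_sq_add, PiLp.sub_apply]
  have h1 : cylRadius (x - x₀) ^ 2 < R ^ 2 :=
    pow_lt_pow_left₀ h.1 (cylRadius_nonneg _) two_ne_zero
  have h2 : (x 2 - x₀ 2) ^ 2 < R ^ 2 := by
    have := h.2
    exact sq_lt_sq' (abs_lt.1 this).1 (abs_lt.1 this).2
  linarith

/-- **Volume of the cylinders**, in the form used below: `|Q(z₀, r)| ≤ 8 |B(0, 1)| r⁵`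
(from the accepted `volume_parCyl_le`: `|Q(z₀, r)| ≤ r² (2r)³ |B₁|`). [folklore] -/
theorem volume_parCyl_le_mul_pow (z₀ : ℝ × ℝ³) {r : ℝ} (hr : 0 < r) :
    volume (parCyl z₀ r) ≤
      ENNReal.ofReal 8 * volume (ball (0 : ℝ³) 1) * ENNReal.ofReal r ^ 5 := by
  refine (volume_parCyl_le z₀ hr).trans (le_of_eq ?_)
  rw [← mul_assoc, ← ENNReal.ofReal_mul (by positivity), mul_comm (ENNReal.ofReal 8 * _),
    ← ENNReal.ofReal_pow hr.le, ← mul_assoc, ← ENNReal.ofReal_mul (by positivity)]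
  congr 2
  ring

/-- Below the top of the cylinder, the support of the scaled cut-off lies in `Q(z₀, r)`.
[folklore] -/
theorem mem_parCyl_of_mem_tsupport_cylCutoff (hr : 0 < r) {z : ℝ × ℝ³}
    (hz : z ∈ tsupport (uncurry (cylCutoff z₀ r))) (ht : z.1 < z₀.1) : z ∈ parCyl z₀ r := by
  obtain ⟨h1, h2⟩ := tsupport_cylCutoff_subset hr hz
  refine ⟨⟨by nlinarith, ht⟩, mem_spaceCyl_of_norm_lt (by linarith)⟩

/-- The support condition of `ae_localEnergy_slice_ennreal_of_forall_lt` for the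
scaled cut-off on a region containing `Q(z₀, r)`. [folklore] -/
theorem tsupport_cylCutoff_inter_subset (hr : 0 < r) {Q : Set (ℝ × ℝ³)}
    (hQ : parCyl z₀ r ⊆ Q) {τ : ℝ} (hτ : τ < z₀.1) :
    tsupport (uncurry (cylCutoff z₀ r)) ∩ {z | z.1 ≤ τ} ⊆ Q := fun _ hz =>
  hQ (mem_parCyl_of_mem_tsupport_cylCutoff hr hz.1 (lt_of_le_of_lt hz.2 hτ))

/-- The scaled cut-off equals `1` on the slices of the half cylinder `Q(z₀, r/2)`. [folklore] -/
theorem cylCutoff_eq_one_of_mem (hr : 0 < r) {t : ℝ} (ht : t ∈ Ioo (z₀.1 - (r / 2) ^ 2) z₀.1)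
    {x : ℝ³} (hx : x ∈ spaceCyl z₀.2 (r / 2)) : cylCutoff z₀ r t x = 1 := by
  refine cylCutoff_eq_one hr ⟨by nlinarith [ht.1], by nlinarith [ht.2]⟩ ?_
  have h2 := norm_sub_sq_lt_of_mem_spaceCyl hx
  nlinarith [norm_nonneg (x - z₀.2)]

/-! ### Bookkeeping in `ℝ≥0∞` -/

/-- `∫_{Q(z₀, r)} |u|³ = r² C(z₀, r; u)` for `r > 0`. [folklore] -/
theorem setLIntegral_eq_mul_cubicC (z₀ : ℝ × ℝ³) {r : ℝ} (hr : 0 < r) (u : ℝ → ℝ³ → ℝ³) :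
    ∫⁻ z in parCyl z₀ r, ‖u z.1 z.2‖ₑ ^ (3 : ℕ) = ENNReal.ofReal r ^ 2 * cubicC z₀ r u := by
  rw [cubicC, ← mul_assoc, ENNReal.mul_inv_cancel (by positivity) (by simp), one_mul]

/-- `(ρ⁵)^{1/3} (ρ²)^{2/3} = ρ³` in `ℝ≥0∞`. [folklore] -/
theorem rpow_five_third_mul_rpow_two (ρ : ℝ≥0∞) :
    (ρ ^ 5) ^ (1 / 3 : ℝ) * (ρ ^ 2) ^ (2 / 3 : ℝ) = ρ ^ 3 := by
  rw [← ENNReal.rpow_natCast ρ 5, ← ENNReal.rpow_natCast ρ 2, ← ENNReal.rpow_natCast ρ 3,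
    ← ENNReal.rpow_mul, ← ENNReal.rpow_mul, ← ENNReal.rpow_add_of_nonneg _ _ (by norm_num)
    (by norm_num)]
  norm_num

/-- `(ρ²)^{2/3} (ρ²)^{1/3} = ρ²` in `ℝ≥0∞`. [folklore] -/
theorem rpow_two_third_mul_rpow_third (x : ℝ≥0∞) :
    x ^ (2 / 3 : ℝ) * x ^ (1 / 3 : ℝ) = x := by
  rw [← ENNReal.rpow_add_of_nonneg _ _ (by norm_num) (by norm_num)]
  norm_num

/-- Young: `D^{2/3} C^{1/3} ≤ D + C` in `ℝ≥0∞`. [folklore] -/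
theorem rpow_two_third_mul_rpow_third_le (C D : ℝ≥0∞) :
    D ^ (2 / 3 : ℝ) * C ^ (1 / 3 : ℝ) ≤ D + C := by
  have h := ENNReal.young_inequality (D ^ (2 / 3 : ℝ)) (C ^ (1 / 3 : ℝ)) (p := 3 / 2) (q := 3)
    (Real.holderConjugate_iff.2 ⟨by norm_num, by norm_num⟩)
  rw [← ENNReal.rpow_mul, ← ENNReal.rpow_mul] at h
  norm_num at h
  refine h.trans (add_le_add ?_ ?_)
  · exact ENNReal.div_le_of_le_mul (le_mul_of_one_le_right (zero_le) (by
      rw [← ENNReal.ofReal_one]; exact ENNReal.ofReal_le_ofReal (by norm_num)))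
  · exact ENNReal.div_le_of_le_mul (le_mul_of_one_le_right (zero_le) (by norm_num))

/-! ### The local energy estimate on `Q(z₀, r)` -/

/-- Pointwise bound for the right-hand integrand of the local energy inequality (`ν = 1`,
`f = 0`) at a point where `|∂ₜζ|, |Δζ| ≤ a` and `‖∇ζ‖ ≤ b`:
`|R[ζ]| ≤ 2a |u|² + b |u|³ + 2b |p| |u|`. [folklore] -/
theorem abs_localEnergyRHS_le {u : ℝ → ℝ³ → ℝ³} {p : ℝ → ℝ³ → ℝ} {ζ : ℝ → ℝ³ → ℝ} {a b : ℝ}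
    {z : ℝ × ℝ³} (ht : |timeDeriv ζ z.1 z.2| ≤ a) (hl : |(Δ (ζ z.1)) z.2| ≤ a)
    (hg : ‖gradient (ζ z.1) z.2‖ ≤ b) :
    |localEnergyRHS 1 0 u p ζ z| ≤
      2 * a * ‖u z.1 z.2‖ ^ 2 + b * ‖u z.1 z.2‖ ^ 3 + 2 * b * (|p z.1 z.2| * ‖u z.1 z.2‖) := by
  rw [localEnergyRHS_apply]
  simp only [Pi.zero_apply, inner_zero_left, mul_zero, zero_mul, add_zero, one_mul]
  have hu := norm_nonneg (u z.1 z.2)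
  have hb : 0 ≤ b := (norm_nonneg _).trans hg
  have hin : |⟪u z.1 z.2, gradient (ζ z.1) z.2⟫| ≤ ‖u z.1 z.2‖ * b :=
    (abs_real_inner_le_norm _ _).trans (mul_le_mul_of_nonneg_left hg hu)
  calc |‖u z.1 z.2‖ ^ 2 * (timeDeriv ζ z.1 z.2 + (Δ (ζ z.1)) z.2) +
        (‖u z.1 z.2‖ ^ 2 + 2 * p z.1 z.2) * ⟪u z.1 z.2, gradient (ζ z.1) z.2⟫|
      ≤ |‖u z.1 z.2‖ ^ 2 * (timeDeriv ζ z.1 z.2 + (Δ (ζ z.1)) z.2)| +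
        |(‖u z.1 z.2‖ ^ 2 + 2 * p z.1 z.2) * ⟪u z.1 z.2, gradient (ζ z.1) z.2⟫| := abs_add_le _ _
    _ = ‖u z.1 z.2‖ ^ 2 * |timeDeriv ζ z.1 z.2 + (Δ (ζ z.1)) z.2| +
        |‖u z.1 z.2‖ ^ 2 + 2 * p z.1 z.2| * |⟪u z.1 z.2, gradient (ζ z.1) z.2⟫| := by
        rw [abs_mul, abs_mul, abs_of_nonneg (sq_nonneg _)]
    _ ≤ ‖u z.1 z.2‖ ^ 2 * (a + a) + (‖u z.1 z.2‖ ^ 2 + 2 * |p z.1 z.2|) * (‖u z.1 z.2‖ * b) := by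
        gcongr
        · exact (abs_add_le _ _).trans (add_le_add ht hl)
        · calc |‖u z.1 z.2‖ ^ 2 + 2 * p z.1 z.2| ≤ |‖u z.1 z.2‖ ^ 2| + |2 * p z.1 z.2| :=
              abs_add_le _ _
            _ = ‖u z.1 z.2‖ ^ 2 + 2 * |p z.1 z.2| := by
              rw [abs_of_nonneg (sq_nonneg _), abs_mul, abs_two]
    _ = 2 * a * ‖u z.1 z.2‖ ^ 2 + b * ‖u z.1 z.2‖ ^ 3 + 2 * b * (|p z.1 z.2| * ‖u z.1 z.2‖) := by
        ring

/-- The same bound in `ℝ≥0∞`: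
`‖R[ζ]‖ₑ ≤ 2a ‖u‖ₑ² + b ‖u‖ₑ³ + 2b ‖p‖ₑ ‖u‖ₑ` (for `a ≥ 0`). [folklore] -/
theorem enorm_localEnergyRHS_le {u : ℝ → ℝ³ → ℝ³} {p : ℝ → ℝ³ → ℝ} {ζ : ℝ → ℝ³ → ℝ} {a b : ℝ}
    (ha : 0 ≤ a) {z : ℝ × ℝ³} (ht : |timeDeriv ζ z.1 z.2| ≤ a) (hl : |(Δ (ζ z.1)) z.2| ≤ a)
    (hg : ‖gradient (ζ z.1) z.2‖ ≤ b) :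
    ‖localEnergyRHS 1 0 u p ζ z‖ₑ ≤
      ENNReal.ofReal (2 * a) * ‖u z.1 z.2‖ₑ ^ 2 + ENNReal.ofReal b * ‖u z.1 z.2‖ₑ ^ (3 : ℕ) +
        ENNReal.ofReal (2 * b) * (‖p z.1 z.2‖ₑ * ‖u z.1 z.2‖ₑ) := by
  have hb : 0 ≤ b := (norm_nonneg _).trans hg
  rw [Real.enorm_eq_ofReal_abs]
  refine (ENNReal.ofReal_le_ofReal (abs_localEnergyRHS_le ht hl hg)).trans (le_of_eq ?_)
  rw [ENNReal.ofReal_add (by positivity) (by positivity),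
    ENNReal.ofReal_add (by positivity) (by positivity),
    ENNReal.ofReal_mul (p := 2 * a) (by positivity), ENNReal.ofReal_mul (p := b) hb,
    ENNReal.ofReal_mul (p := 2 * b) (by positivity),
    ENNReal.ofReal_mul (p := |p z.1 z.2|) (abs_nonneg _), ENNReal.ofReal_pow (norm_nonneg _),
    ENNReal.ofReal_pow (norm_nonneg _), ofReal_norm, ← Real.enorm_eq_ofReal_abs]

/-- **Seregin–Šverák 2009, (as12), for suitable weak solutions** (the "routine" local energy
estimate behind the proof of Lemma 3.5, arXiv p. 10; Caffarelli–Kohn–Nirenberg 1982, §2;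
Lin 1998, §2): there is a universal constant `c` such that for every suitable weak solution
`(u, p)` of the Navier–Stokes system (`ν = 1`, no force) on an open `Q ⊆ ℝ × ℝ³` with
`|u|³ ∈ L¹_loc(Q)`, every weak spatial gradient `G` of `u` on `Q` and every cylinder
`Q(z₀, r) ⊆ Q`, `r > 0`,
`E(z₀, r/2; G) + A(z₀, r/2; u) ≤ c (C^{2/3}(z₀, r; u) + C(z₀, r; u) + D(z₀, r; p))`.
Proof: the sliced local energy inequality (`SuitableWeakSliced.lean`) tested with the scaled
cut-off `cylCutoff z₀ r` (`= 1` on `Q(z₀, r/2)`, supported in `Q(z₀, r)` below `t₀`,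
`|∂ₜΦ| + |ΔΦ| ≤ c/r²`, `|∇Φ| ≤ c/r`), Hölder (`∫_{Q_r}|u|² ≤ |Q_r|^{1/3} (∫|u|³)^{2/3}`,
`∫|p||u| ≤ (∫|p|^{3/2})^{2/3} (∫|u|³)^{1/3}`) and Young.
[cite: SereginSverak2009, proof of Lemma 3.5, (as12)] -/
theorem dissipationE_add_energyA_le_of_suitable :
    ∃ c : ℝ≥0, ∀ (Q : Opens (ℝ × ℝ³)) (u : ℝ → ℝ³ → ℝ³) (p : ℝ → ℝ³ → ℝ)
      (G : ℝ → ℝ³ → ℝ³ →L[ℝ] ℝ³), IsSuitableWeakSolutionOn Q 1 0 u p →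
      LocallyIntegrableOn (fun z : ℝ × ℝ³ => ‖u z.1 z.2‖ ^ 3) Q volume →
      HasWeakSpatialGradientOn Q u G →
      ∀ (z₀ : ℝ × ℝ³) (r : ℝ), 0 < r → parCyl z₀ r ⊆ (Q : Set (ℝ × ℝ³)) →
        dissipationE z₀ (r / 2) G + energyA z₀ (r / 2) u ≤
          c * (cubicC z₀ r u ^ (2 / 3 : ℝ) + cubicC z₀ r u + pressureD z₀ r p) := by
  obtain ⟨M, hM0, hM⟩ := exists_unitCutoff_deriv_bound
  -- the volume constant `(8 |B(0,1)|)^{1/3}`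
  set KV : ℝ≥0∞ := (ENNReal.ofReal 8 * volume (ball (0 : ℝ³) 1)) ^ (1 / 3 : ℝ) with hKV
  have hKVtop : KV ≠ ⊤ := ENNReal.rpow_ne_top_of_nonneg (by norm_num)
    (ENNReal.mul_ne_top ENNReal.ofReal_ne_top measure_ball_lt_top.ne)
  set M' : ℝ≥0 := M.toNNReal with hM'
  have hMM' : ENNReal.ofReal M = (M' : ℝ≥0∞) := rfl
  refine ⟨8 * M' * KV.toNNReal + 12 * M' + 1, ?_⟩
  intro Q u p G hsw hu3 hG z₀ r hr hQr
  have hcoe : ((8 * M' * KV.toNNReal + 12 * M' + 1 : ℝ≥0) : ℝ≥0∞) =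
      8 * (M' : ℝ≥0∞) * KV + 12 * (M' : ℝ≥0∞) + 1 := by
    push_cast
    rw [ENNReal.coe_toNNReal hKVtop]
  rw [hcoe]
  set C := cubicC z₀ r u with hCdef
  set D := pressureD z₀ r p with hDdef
  -- the estimate is trivial unless `C, D < ∞`
  have hc1 : (1 : ℝ≥0∞) ≤ 8 * (M' : ℝ≥0∞) * KV + 12 * (M' : ℝ≥0∞) + 1 := le_add_self
  rcases eq_or_ne C ⊤ with hC | hC
  · refine le_trans le_top (le_of_eq ?_)
    rw [hC, ENNReal.top_rpow_of_pos (by norm_num), top_add, top_add, ENNReal.mul_top]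
    exact (lt_of_lt_of_le zero_lt_one hc1).ne'
  rcases eq_or_ne D ⊤ with hD | hD
  · refine le_trans le_top (le_of_eq ?_)
    rw [hD, add_top, ENNReal.mul_top]
    exact (lt_of_lt_of_le zero_lt_one hc1).ne'
  -- notation and finiteness
  set ρ : ℝ≥0∞ := ENNReal.ofReal r with hρ
  have hρ0 : ρ ≠ 0 := (ENNReal.ofReal_pos.2 hr).ne'
  have hρt : ρ ≠ ⊤ := ENNReal.ofReal_ne_top
  have hX : ∫⁻ z in parCyl z₀ r, ‖u z.1 z.2‖ₑ ^ (3 : ℕ) = ρ ^ 2 * C :=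
    setLIntegral_eq_mul_cubicC z₀ hr u
  have hY : ∫⁻ z in parCyl z₀ r, ‖p z.1 z.2‖ₑ ^ (3 / 2 : ℝ) = ρ ^ 2 * D :=
    setLIntegral_eq_mul_pressureD z₀ hr p
  -- measurability on `Q(z₀, r)`
  have hμ : volume.restrict (parCyl z₀ r) ≤ volume.restrict (Q : Set (ℝ × ℝ³)) :=
    Measure.restrict_mono hQr le_rfl
  have hum : AEStronglyMeasurable (fun z : ℝ × ℝ³ => u z.1 z.2) (volume.restrict (parCyl z₀ r)) :=
    hsw.distributional.1.aestronglyMeasurable.mono_measure hμ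
  have hpm : AEStronglyMeasurable (fun z : ℝ × ℝ³ => p z.1 z.2) (volume.restrict (parCyl z₀ r)) :=
    hsw.distributional.2.2.1.aestronglyMeasurable.mono_measure hμ
  -- the cut-off and the sliced local energy inequality below `t₀`
  have hΦtest := isSpaceTimeTestOn_cylCutoff z₀ hr.ne'
  have hfu : LocallyIntegrableOn
      (fun z : ℝ × ℝ³ => ⟪(0 : ℝ → ℝ³ → ℝ³) z.1 z.2, u z.1 z.2⟫) Q volume := by
    have e : (fun z : ℝ × ℝ³ => ⟪(0 : ℝ → ℝ³ → ℝ³) z.1 z.2, u z.1 z.2⟫) = fun _ => (0 : ℝ) := by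
      funext z
      simp
    rw [e]
    exact locallyIntegrableOn_const _
  have hmeasS : ∀ s : ℝ, MeasurableSet {z : ℝ × ℝ³ | z.1 < s} := fun s =>
    measurableSet_lt measurable_fst measurable_const
  have hF2 := hsw.ae_localEnergy_slice_ennreal_of_forall_lt hG hu3 hfu hΦtest
    (cylCutoff_nonneg z₀ r) zero_le_one (T := z₀.1)
    (fun τ hτ => tsupport_cylCutoff_inter_subset hr hQr hτ)
  -- the common bound `𝔅`
  set B : ℝ × ℝ³ → ℝ≥0∞ := fun z => ENNReal.ofReal (2 * (M / r ^ 2)) * ‖u z.1 z.2‖ₑ ^ 2 +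
      ENNReal.ofReal (M / r) * ‖u z.1 z.2‖ₑ ^ (3 : ℕ) +
      ENNReal.ofReal (2 * (M / r)) * (‖p z.1 z.2‖ₑ * ‖u z.1 z.2‖ₑ) with hB
  set 𝔅 : ℝ≥0∞ := ENNReal.ofReal (2 * (M / r ^ 2)) * (∫⁻ z in parCyl z₀ r, ‖u z.1 z.2‖ₑ ^ 2) +
      ENNReal.ofReal (M / r) * (∫⁻ z in parCyl z₀ r, ‖u z.1 z.2‖ₑ ^ (3 : ℕ)) +
      ENNReal.ofReal (2 * (M / r)) * (∫⁻ z in parCyl z₀ r, ‖p z.1 z.2‖ₑ * ‖u z.1 z.2‖ₑ) with h𝔅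
  have hB𝔅 : ∫⁻ z in parCyl z₀ r, B z = 𝔅 := by
    have m1 : AEMeasurable (fun z : ℝ × ℝ³ => ENNReal.ofReal (2 * (M / r ^ 2)) * ‖u z.1 z.2‖ₑ ^ 2)
        (volume.restrict (parCyl z₀ r)) := (hum.enorm.pow_const _).const_mul _
    have m12 : AEMeasurable (fun z : ℝ × ℝ³ => ENNReal.ofReal (2 * (M / r ^ 2)) * ‖u z.1 z.2‖ₑ ^ 2 +
        ENNReal.ofReal (M / r) * ‖u z.1 z.2‖ₑ ^ (3 : ℕ)) (volume.restrict (parCyl z₀ r)) :=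
      m1.add ((hum.enorm.pow_const _).const_mul _)
    simp only [hB, h𝔅]
    rw [lintegral_add_left' m12, lintegral_add_left' m1,
      lintegral_const_mul' _ _ ENNReal.ofReal_ne_top,
      lintegral_const_mul' _ _ ENNReal.ofReal_ne_top,
      lintegral_const_mul' _ _ ENNReal.ofReal_ne_top]
  -- (i) pointwise bound of the right-hand integrand below `t₀`
  have hpt : ∀ z : ℝ × ℝ³, z.1 < z₀.1 →
      ‖localEnergyRHS 1 0 u p (cylCutoff z₀ r) z‖ₑ ≤ (parCyl z₀ r).indicator B z := by
    intro z hzt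
    by_cases hz : z ∈ tsupport (uncurry (cylCutoff z₀ r))
    · rw [indicator_of_mem (mem_parCyl_of_mem_tsupport_cylCutoff hr hz hzt)]
      obtain ⟨h1, h2, h3⟩ := cylCutoff_deriv_bound (z₀ := z₀) hM hr z.1 z.2
      exact enorm_localEnergyRHS_le (div_nonneg hM0 (by positivity)) h1 h2 h3
    · have h0 := weights_eq_zero_of_notMem_tsupport hz
      have e : localEnergyRHS 1 0 u p (cylCutoff z₀ r) z = 0 := by
        rw [localEnergyRHS_apply, h0.1, h0.2.1, h0.2.2.1, h0.2.2.2]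
        simp
      rw [e, enorm_zero]
      exact zero_le
  -- (ii) the right-hand side below `t₀` is bounded by `𝔅`
  have hRHS : ∀ s < z₀.1, ENNReal.ofReal
      (∫ z in {z : ℝ × ℝ³ | z.1 < s}, localEnergyRHS 1 0 u p (cylCutoff z₀ r) z) ≤ 𝔅 := by
    intro s hs
    calc ENNReal.ofReal (∫ z in {z : ℝ × ℝ³ | z.1 < s}, localEnergyRHS 1 0 u p (cylCutoff z₀ r) z)
        ≤ ‖∫ z in {z : ℝ × ℝ³ | z.1 < s}, localEnergyRHS 1 0 u p (cylCutoff z₀ r) z‖ₑ :=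
          Real.ofReal_le_enorm _
      _ ≤ ∫⁻ z in {z : ℝ × ℝ³ | z.1 < s}, ‖localEnergyRHS 1 0 u p (cylCutoff z₀ r) z‖ₑ :=
          enorm_integral_le_lintegral_enorm _
      _ ≤ ∫⁻ z in {z : ℝ × ℝ³ | z.1 < s}, (parCyl z₀ r).indicator B z :=
          setLIntegral_mono' (hmeasS s) fun z hz => hpt z (lt_trans hz hs)
      _ ≤ ∫⁻ z, (parCyl z₀ r).indicator B z := setLIntegral_le_lintegral _ _
      _ = 𝔅 := by rw [lintegral_indicator (isOpen_parCyl z₀ r).measurableSet, hB𝔅]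
  -- (iii) the `A` term
  have hA : energyA z₀ (r / 2) u ≤ (ENNReal.ofReal (r / 2))⁻¹ * 𝔅 := by
    refine essSup_le_of_ae_le _ ((ae_restrict_iff' measurableSet_Ioo).2 ?_)
    filter_upwards [hF2] with s hs hsI
    refine mul_le_mul_right ?_ _
    calc ∫⁻ x in spaceCyl z₀.2 (r / 2), ‖u s x‖ₑ ^ 2
        = ∫⁻ x in spaceCyl z₀.2 (r / 2), ‖u s x‖ₑ ^ 2 * ENNReal.ofReal (cylCutoff z₀ r s x) :=
          setLIntegral_congr_fun (isOpen_spaceCyl _ _).measurableSet fun x hx => by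
            rw [cylCutoff_eq_one_of_mem hr hsI hx, ENNReal.ofReal_one, mul_one]
      _ ≤ ∫⁻ x, ‖u s x‖ₑ ^ 2 * ENNReal.ofReal (cylCutoff z₀ r s x) :=
          setLIntegral_le_lintegral _ _
      _ ≤ _ := le_self_add
      _ ≤ _ := hs hsI.2
      _ ≤ 𝔅 := hRHS s hsI.2
  -- (iv) the `E` term, through increasing levels `sₙ ↑ t₀`
  have hE : dissipationE z₀ (r / 2) G ≤ (ENNReal.ofReal (r / 2))⁻¹ * 𝔅 := by
    refine mul_le_mul_right ?_ _
    set sN : ℕ → ℝ := fun n => z₀.1 - (r / 2) ^ 2 / ((n : ℝ) + 2) with hsN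
    have hsN_lt : ∀ n, sN n < z₀.1 := fun n => by
      simp only [hsN]
      have : 0 < (r / 2) ^ 2 / ((n : ℝ) + 2) := by positivity
      linarith
    have hsN_gt : ∀ n, z₀.1 - (r / 2) ^ 2 < sN n := fun n => by
      simp only [hsN]
      have h2 : (r / 2) ^ 2 / ((n : ℝ) + 2) < (r / 2) ^ 2 := by
        rw [div_lt_iff₀ (by positivity)]
        nlinarith [sq_nonneg (r / 2), hr]
      linarith
    set S : ℕ → Set (ℝ × ℝ³) := fun n => parCyl z₀ (r / 2) ∩ {z | z.1 < sN n} with hS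
    have hSmono : Monotone S := by
      intro n m hnm z hz
      have h1 : (r / 2) ^ 2 / ((m : ℝ) + 2) ≤ (r / 2) ^ 2 / ((n : ℝ) + 2) :=
        div_le_div_of_nonneg_left (sq_nonneg _) (by positivity)
          (by simpa using (Nat.cast_le (α := ℝ)).2 hnm)
      have h2 : sN n ≤ sN m := by
        simp only [hsN]
        linarith
      exact ⟨hz.1, lt_of_lt_of_le (hz.2 : z.1 < sN n) h2⟩
    have hSU : ⋃ n, S n = parCyl z₀ (r / 2) := by
      refine subset_antisymm (iUnion_subset fun n => inter_subset_left) fun z hz => ?_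
      have hgap : 0 < z₀.1 - z.1 := by linarith [hz.1.2]
      obtain ⟨n, hn⟩ := exists_nat_gt ((r / 2) ^ 2 / (z₀.1 - z.1))
      refine mem_iUnion.2 ⟨n, hz, ?_⟩
      show z.1 < z₀.1 - (r / 2) ^ 2 / ((n : ℝ) + 2)
      have h1 : (r / 2) ^ 2 / ((n : ℝ) + 2) < z₀.1 - z.1 := by
        rw [div_lt_iff₀ (by positivity)]
        rw [div_lt_iff₀ hgap] at hn
        nlinarith
      linarith
    -- for each level a good slicing time above it
    have hgood : ∀ n, ∫⁻ z in S n, ENNReal.ofReal (frobeniusNormSq (G z.1 z.2)) ≤ 𝔅 := by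
      intro n
      haveI : NeZero ((volume : Measure ℝ).restrict (Ioo (sN n) z₀.1)) := ⟨by
        rw [Ne, Measure.restrict_eq_zero, Real.volume_Ioo, ENNReal.ofReal_eq_zero, not_le]
        linarith [hsN_lt n]⟩
      obtain ⟨s, hs, hsI⟩ := ((ae_restrict_of_ae (s := Ioo (sN n) z₀.1) hF2).and
        (ae_restrict_mem measurableSet_Ioo)).exists
      have hsub : S n ⊆ {z : ℝ × ℝ³ | z.1 < s} := fun z hz => lt_trans hz.2 hsI.1
      calc ∫⁻ z in S n, ENNReal.ofReal (frobeniusNormSq (G z.1 z.2))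
          = ∫⁻ z in S n, ENNReal.ofReal (frobeniusNormSq (G z.1 z.2)) *
              ENNReal.ofReal (cylCutoff z₀ r z.1 z.2) :=
            setLIntegral_congr_fun ((isOpen_parCyl _ _).measurableSet.inter
              (isOpen_lt continuous_fst continuous_const).measurableSet) fun z hz => by
              rw [cylCutoff_eq_one_of_mem hr ⟨?_, hz.1.1.2⟩ hz.1.2, ENNReal.ofReal_one, mul_one]
              have := hz.1.1.1
              simpa using this
        _ ≤ ∫⁻ z in {z : ℝ × ℝ³ | z.1 < s}, ENNReal.ofReal (frobeniusNormSq (G z.1 z.2)) *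
              ENNReal.ofReal (cylCutoff z₀ r z.1 z.2) := lintegral_mono_set hsub
        _ ≤ ENNReal.ofReal (2 * 1) * ∫⁻ z in {z : ℝ × ℝ³ | z.1 < s},
              ENNReal.ofReal (frobeniusNormSq (G z.1 z.2)) *
                ENNReal.ofReal (cylCutoff z₀ r z.1 z.2) :=
            le_mul_of_one_le_left (zero_le) (by simp)
        _ ≤ _ := le_add_self
        _ ≤ _ := hs hsI.2
        _ ≤ 𝔅 := hRHS s hsI.2
    rw [← hSU, setLIntegral_iUnion_of_directed _ hSmono.directed_le]
    exact iSup_le hgood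
  -- (v) Hölder bounds
  have hpq : (3 : ℝ).HolderConjugate (3 / 2) :=
    Real.holderConjugate_iff.2 ⟨by norm_num, by norm_num⟩
  have hW : ∫⁻ z in parCyl z₀ r, ‖u z.1 z.2‖ₑ ^ 2 ≤ KV * ρ ^ 3 * C ^ (2 / 3 : ℝ) := by
    have h := ENNReal.lintegral_mul_le_Lp_mul_Lq (volume.restrict (parCyl z₀ r)) hpq
      (f := fun _ => (1 : ℝ≥0∞)) (g := fun z => ‖u z.1 z.2‖ₑ ^ 2) aemeasurable_const
      (hum.enorm.pow_const 2)
    simp only [Pi.mul_apply, one_mul, ENNReal.one_rpow, setLIntegral_const] at h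
    have e1 : ∀ z : ℝ × ℝ³, (‖u z.1 z.2‖ₑ ^ 2) ^ (3 / 2 : ℝ) = ‖u z.1 z.2‖ₑ ^ (3 : ℕ) := fun z => by
      rw [← ENNReal.rpow_natCast _ 2, ← ENNReal.rpow_mul, ← ENNReal.rpow_natCast _ 3]
      norm_num
    simp only [e1] at h
    rw [hX] at h
    refine h.trans ?_
    calc (volume (parCyl z₀ r)) ^ (1 / (3 : ℝ)) * (ρ ^ 2 * C) ^ (1 / (3 / 2 : ℝ))
        ≤ (ENNReal.ofReal 8 * volume (ball (0 : ℝ³) 1) * ρ ^ 5) ^ (1 / (3 : ℝ)) *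
            (ρ ^ 2 * C) ^ (1 / (3 / 2 : ℝ)) := by
          gcongr
          exact volume_parCyl_le_mul_pow z₀ hr
      _ = KV * ρ ^ 3 * C ^ (2 / 3 : ℝ) := by
          rw [ENNReal.mul_rpow_of_nonneg _ _ (by norm_num : (0 : ℝ) ≤ 1 / 3),
            ENNReal.mul_rpow_of_nonneg _ _ (by norm_num : (0 : ℝ) ≤ 1 / (3 / 2)), ← hKV,
            show (1 / (3 / 2 : ℝ)) = 2 / 3 by norm_num, mul_assoc, mul_assoc,
            ← mul_assoc ((ρ ^ 5) ^ _), rpow_five_third_mul_rpow_two]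
  have hZ : ∫⁻ z in parCyl z₀ r, ‖p z.1 z.2‖ₑ * ‖u z.1 z.2‖ₑ ≤ ρ ^ 2 * (D + C) := by
    have hpq' : (3 / 2 : ℝ).HolderConjugate 3 :=
      Real.holderConjugate_iff.2 ⟨by norm_num, by norm_num⟩
    have h := ENNReal.lintegral_mul_le_Lp_mul_Lq (volume.restrict (parCyl z₀ r)) hpq'
      (f := fun z => ‖p z.1 z.2‖ₑ) (g := fun z => ‖u z.1 z.2‖ₑ) hpm.enorm hum.enorm
    simp only [Pi.mul_apply] at h
    have e3 : ∀ z : ℝ × ℝ³, ‖u z.1 z.2‖ₑ ^ (3 : ℝ) = ‖u z.1 z.2‖ₑ ^ (3 : ℕ) := fun z => by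
      rw [← ENNReal.rpow_natCast _ 3]
      norm_num
    simp only [e3] at h
    rw [hX, hY] at h
    refine h.trans ?_
    rw [ENNReal.mul_rpow_of_nonneg _ _ (by norm_num : (0 : ℝ) ≤ 1 / (3 / 2)),
      ENNReal.mul_rpow_of_nonneg _ _ (by norm_num : (0 : ℝ) ≤ 1 / 3),
      show (1 / (3 / 2 : ℝ)) = 2 / 3 by norm_num]
    calc (ρ ^ 2) ^ (2 / 3 : ℝ) * D ^ (2 / 3 : ℝ) * ((ρ ^ 2) ^ (1 / 3 : ℝ) * C ^ (1 / 3 : ℝ))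
        = ((ρ ^ 2) ^ (2 / 3 : ℝ) * (ρ ^ 2) ^ (1 / 3 : ℝ)) *
            (D ^ (2 / 3 : ℝ) * C ^ (1 / 3 : ℝ)) := by
          ring
      _ ≤ ρ ^ 2 * (D + C) := by
          rw [rpow_two_third_mul_rpow_third]
          exact mul_le_mul_right (rpow_two_third_mul_rpow_third_le C D) _
  -- (vi) assembling
  have hr2 : (ENNReal.ofReal (r / 2))⁻¹ = ENNReal.ofReal (2 / r) := by
    rw [← ENNReal.ofReal_inv_of_pos (by positivity), inv_div]
  have key : (ENNReal.ofReal (r / 2))⁻¹ * 𝔅 ≤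
      4 * (M' : ℝ≥0∞) * KV * C ^ (2 / 3 : ℝ) + 2 * (M' : ℝ≥0∞) * C + 4 * (M' : ℝ≥0∞) * (D + C) := by
    rw [hr2, h𝔅, hX, mul_add, mul_add]
    refine add_le_add (add_le_add ?_ ?_) ?_
    · calc ENNReal.ofReal (2 / r) * (ENNReal.ofReal (2 * (M / r ^ 2)) *
            ∫⁻ z in parCyl z₀ r, ‖u z.1 z.2‖ₑ ^ 2)
          ≤ ENNReal.ofReal (2 / r) *
              (ENNReal.ofReal (2 * (M / r ^ 2)) * (KV * ρ ^ 3 * C ^ (2 / 3 : ℝ))) := by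
            gcongr
        _ = (ENNReal.ofReal (2 / r) * ENNReal.ofReal (2 * (M / r ^ 2)) * ρ ^ 3) * KV *
            C ^ (2 / 3 : ℝ) := by ring
        _ = 4 * (M' : ℝ≥0∞) * KV * C ^ (2 / 3 : ℝ) := by
            rw [hρ, ← ENNReal.ofReal_pow hr.le, ← ENNReal.ofReal_mul (by positivity),
              ← ENNReal.ofReal_mul (by positivity),
              show 2 / r * (2 * (M / r ^ 2)) * r ^ 3 = 4 * M by field_simp; ring,
              ENNReal.ofReal_mul (by norm_num), hMM', ENNReal.ofReal_ofNat]
    · calc ENNReal.ofReal (2 / r) * (ENNReal.ofReal (M / r) * (ρ ^ 2 * C))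
          = (ENNReal.ofReal (2 / r) * ENNReal.ofReal (M / r) * ρ ^ 2) * C := by ring
        _ = 2 * (M' : ℝ≥0∞) * C := by
            rw [hρ, ← ENNReal.ofReal_pow hr.le, ← ENNReal.ofReal_mul (by positivity),
              ← ENNReal.ofReal_mul (by positivity),
              show 2 / r * (M / r) * r ^ 2 = 2 * M by field_simp,
              ENNReal.ofReal_mul (by norm_num), hMM', ENNReal.ofReal_ofNat]
        _ ≤ 2 * (M' : ℝ≥0∞) * C := le_rfl
    · calc ENNReal.ofReal (2 / r) * (ENNReal.ofReal (2 * (M / r)) *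
            ∫⁻ z in parCyl z₀ r, ‖p z.1 z.2‖ₑ * ‖u z.1 z.2‖ₑ)
          ≤ ENNReal.ofReal (2 / r) * (ENNReal.ofReal (2 * (M / r)) * (ρ ^ 2 * (D + C))) := by
            gcongr
        _ = (ENNReal.ofReal (2 / r) * ENNReal.ofReal (2 * (M / r)) * ρ ^ 2) * (D + C) := by ring
        _ = 4 * (M' : ℝ≥0∞) * (D + C) := by
            rw [hρ, ← ENNReal.ofReal_pow hr.le, ← ENNReal.ofReal_mul (by positivity),
              ← ENNReal.ofReal_mul (by positivity),
              show 2 / r * (2 * (M / r)) * r ^ 2 = 4 * M by field_simp; ring,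
              ENNReal.ofReal_mul (by norm_num), hMM', ENNReal.ofReal_ofNat]
  calc dissipationE z₀ (r / 2) G + energyA z₀ (r / 2) u
      ≤ (ENNReal.ofReal (r / 2))⁻¹ * 𝔅 + (ENNReal.ofReal (r / 2))⁻¹ * 𝔅 := add_le_add hE hA
    _ ≤ 2 * (4 * (M' : ℝ≥0∞) * KV * C ^ (2 / 3 : ℝ) + 2 * (M' : ℝ≥0∞) * C +
          4 * (M' : ℝ≥0∞) * (D + C)) := by
        rw [two_mul]
        exact add_le_add key key
    _ = 8 * (M' : ℝ≥0∞) * KV * C ^ (2 / 3 : ℝ) + 12 * (M' : ℝ≥0∞) * C + 8 * (M' : ℝ≥0∞) * D := by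
        ring
    _ ≤ (8 * (M' : ℝ≥0∞) * KV + 12 * (M' : ℝ≥0∞) + 1) * C ^ (2 / 3 : ℝ) +
          (8 * (M' : ℝ≥0∞) * KV + 12 * (M' : ℝ≥0∞) + 1) * C +
          (8 * (M' : ℝ≥0∞) * KV + 12 * (M' : ℝ≥0∞) + 1) * D := by
        refine add_le_add (add_le_add ?_ ?_) ?_
        · exact mul_le_mul_left (by rw [add_assoc]; exact le_self_add) _
        · exact mul_le_mul_left ((le_add_left le_rfl).trans le_self_add) _
        · refine mul_le_mul_left ?_ _
          calc 8 * (M' : ℝ≥0∞) ≤ 12 * (M' : ℝ≥0∞) := mul_le_mul_left (by norm_num) _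
            _ ≤ _ := (le_add_left le_rfl).trans le_self_add
    _ = (8 * (M' : ℝ≥0∞) * KV + 12 * (M' : ℝ≥0∞) + 1) * (C ^ (2 / 3 : ℝ) + C + D) := by ring

/-! ### (as12) from Remark 3.4 -/

/-- `u ∈ L³(Q)` (a standing assumption of §3) makes `|u|³` locally integrable on `Q`.
[cite: SereginSverak2009, §3 (standing assumptions, arXiv p. 9)] -/
theorem IsAxisymmetricLocalSolution.locallyIntegrableOn_norm_pow_three {u : ℝ → ℝ³ → ℝ³}
    {p : ℝ → ℝ³ → ℝ} (hsol : IsAxisymmetricLocalSolution u p) :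
    LocallyIntegrableOn (fun z : ℝ × ℝ³ => ‖u z.1 z.2‖ ^ 3)
      ((parCylOpens 0 1 : Opens (ℝ × ℝ³)) : Set (ℝ × ℝ³)) volume := by
  refine IntegrableOn.locallyIntegrableOn ⟨?_, ?_⟩
  · exact (hsol.distributional.1.aestronglyMeasurable.norm.pow 3)
  · rw [hasFiniteIntegral_iff_enorm, coe_parCylOpens]
    refine lt_of_le_of_lt (le_of_eq (lintegral_congr fun z => ?_)) hsol.velocity_L3
    rw [Real.enorm_eq_ofReal (by positivity), ENNReal.ofReal_pow (norm_nonneg _), ofReal_norm]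

/-- **Seregin–Šverák 2009, (as12) from Remark 3.4.** The local energy estimate (as12) of the
proof of Lemma 3.5 — the named fact `LocalEnergyEstimate` — follows from Remark 3.4 (the named
fact `SuitableOfBounded`: under the standing assumptions, axial symmetry and (r2), `(v, q)` is a
suitable weak solution in `Q`), exactly as the paper says ("In addition to (as11), we consider
the local energy inequality (as12)", arXiv p. 10): (r3) gives (r2)
(`isBoundedAwayFromZero_of_isTypeIOnCyl`), Remark 3.4 gives suitability in `Q`, and
`dissipationE_add_energyA_le_of_suitable` applies on every `Q(z_b, r) ⊆ Q(0, 1)`, `|b| ≤ 1/4`,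
`0 < r < 1/4`. [cite: SereginSverak2009, proof of Lemma 3.5, (as12), with Remark 3.4] -/
theorem LocalEnergyEstimate.of_suitable (h34 : SuitableOfBounded) : LocalEnergyEstimate := by
  obtain ⟨c, hc⟩ := dissipationE_add_energyA_le_of_suitable
  refine ⟨c, fun u p hsol hI G hG b hb r hr => ?_⟩
  have hsw : IsSuitableWeakSolutionOn (parCylOpens 0 1) 1 0 u p :=
    h34 u p hsol (isBoundedAwayFromZero_of_isTypeIOnCyl hI)
  have hsub : parCyl ((0 : ℝ), b • eZ) r ⊆ ((parCylOpens 0 1 : Opens (ℝ × ℝ³)) : Set (ℝ × ℝ³)) := by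
    rw [coe_parCylOpens]
    exact parCyl_axis_subset hr.1.le (by linarith [hr.2])
  exact hc _ u p G hsw hsol.locallyIntegrableOn_norm_pow_three hG ((0 : ℝ), b • eZ) r hr.1 hsub

/-- **Discharge of `SereginSverak2009.LocalEnergyEstimate` (Seregin–Šverák 2009, proof of
Lemma 3.5, (as12)).** Unconditional: Remark 3.4 is the accepted theorem
`SuitableOfBounded_holds` (`SereginSverakSuitableProofs.lean`, bounded distributional
solutions are suitable), and (as12) follows from it by `LocalEnergyEstimate.of_suitable`.
[cite: SereginSverak2009, proof of Lemma 3.5, (as12), with Remark 3.4] -/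
theorem LocalEnergyEstimate_holds : LocalEnergyEstimate :=
  LocalEnergyEstimate.of_suitable SuitableOfBounded_holds

/-- **Lemma 3.5 from its two remaining inputs (as6) and (as13).** With (as11)
(`CubicAbsorption_holds`, `SereginSverakScaledEnergyProofs.lean`) and (as12)
(`LocalEnergyEstimate_holds`) discharged, the scaled energy bound `ScaledEnergyBound` follows
from the gradient/energy bound (as6) (`GradientEnergyBound`: Lemma 3.3 + Remark 3.4, i.e.
`A(0, 3/4) + E(0, 3/4) < ∞`) and the pressure decay estimate (as13) (`PressureDecay`) through
the accepted iteration `ScaledEnergyBound.of_inputs`.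
[cite: SereginSverak2009, Lemma 3.5 and its proof (arXiv pp. 9–10)] -/
theorem ScaledEnergyBound.of_gradientEnergyBound_of_pressureDecay (h6 : GradientEnergyBound)
    (h13 : PressureDecay) : ScaledEnergyBound :=
  ScaledEnergyBound.of_inputs h6 CubicAbsorption_holds LocalEnergyEstimate_holds h13

end SereginSverak2009

end Literature.Analysis.FluidPDE
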